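import Mathlib
import HarnessLib
import HarnessLib.Audit
import Summits.Parity.Statement
import Literature.NumberTheory.LFunctions.Zhang2022.KnifeEdgeLenZDegreePack
import Literature.NumberTheory.LFunctions.Zhang2022.KnifeEdgeLenZDegreeBarrier
import Literature.NumberTheory.LFunctions.Zhang2022.KnifeEdgeLenZDegreePsiOn
import Literature.NumberTheory.LFunctions.Zhang2022.KnifeEdgeLenZDegreeClosedForms
import Literature.NumberTheory.LFunctions.Zhang2022.KnifeEdgeLenZDegreeK0Piece
import Literature.NumberTheory.LFunctions.Zhang2022.KnifeEdgeLenZDegreeK0Poly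
import Literature.NumberTheory.LFunctions.Zhang2022.SkeletonSetting

/-!
Route: ZDegreeToeplitzBand

DORMANT since 2026-09-03T13:03:46Z (reconciler: no traction for 5 d (last activity statement-checked at 2026-08-29T12:23:10Z); parked, not closed — `ledger route dormant route-Parity-ZDegreeToeplitzBand --off` to reactivate) — unstaffed, not closed; items shared with open routes are served there. `ledger route dormant <id> --off` reactivates.

# Route ZDegreeToeplitzBand — root-number-graded test vectors make Zhang's Gram tables Toeplitz; the
degree-2 table is a length lever past the knife edge

X = «Zhang's side tables hold for every kinked in-class piece (K0) AND, on the horn where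
(A)-characters recur, the ψ-GRADED 3×3 Gram
table of the design (H_f, Z(ρ,ψ)·conj Q_{g₁}, Z(ρ,ψ)²·conj Q_{g₂}) has main-term functionals X₁^ψ
(degree-1 cross), Y₁^ψ (degree-1
dual), X₂^ψ (degree-2 = the NEW table τ₂) (K1) which make the graded main-term matrix fail PSD on
some in-class design (K2)». In the
tree's names X = (∃ c₀, ∀ c' ≥ c₀, `KnifeEdge.InClassMean c'`) ∧ (∃ c₀, ∀ c' ≥ c₀,
`KnifeEdge.GradedClosesPsi c'`) — typer-1's packaged
crux (p485599/p485893, critic's option β), decomposed here ONE LEVEL DOWN along its only seam: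
EXISTENCE of the tables (K1, any
functionals) / SIGN (K2: whatever functionals satisfy the tables close; they are pinned on in-class
pieces by `KnifeEdge.crossTablePsi_unique`,
p485449). It suffices: Zhang's positivity inequality (2.16) evaluated on that design is then
negative at main order under (A), so (A)
fails for all large D, which is Theorem 1 by the tree
(`theorem1_of_gradedClosesPsi_pack_eventually`; the ¬(A)-eventually horn is
`Skeleton.theorem1_of_eventually_not_assumptionA`). Leaf = `Zhang2022.Skeleton.Theorem1` (a
positivity-inequality line, not
zero-free-region shaped). Realises card `z-degree-toeplitz-band` (grade new-mechanism, CRIT-1 v1.0;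
K1″ repaired inside the A0 gate).
KERNEL FACT (crit-1 C0 finding 02:52:02Z, tree
`KnifeEdge.gradedClosesPsi_iff_notAEventually_closed`, p489549): for c′ ≥ c₀ and given
`InClassMean c'`, `GradedClosesPsi c' ↔ ForAllLarge ¬(A)` — so the typed package (and K2 given K0 ∧
K1) has no attack surface beyond
Theorem 1's own; the route's deciding content is FORMULA-LEVEL: explicit closed-form functionals
X₁^ψ, Y₁^ψ, X₂^ψ (item α1), their slot
theorems (α2 = K1 made explicit; K1″a `DiagMain` + K1″b `WrapNegligible`, glued by tree
`tauTwoTablePsi_of_split`, p487998) and the (A)-FREE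
calculus statement `GradedCloses X₁^ψ Y₁^ψ X₂^ψ` vs its barrier twin `GradedPSD X₁^ψ Y₁^ψ X₂^ψ` (α3
= K2's kernel form) — filed as informal
ledger items right after open (crit-1 REQUIREMENT 02:52:02Z / 02:53:24Z; signatures when the
archimedean census pins the formulas); the typed
K2 stays as the glue-facing package that `closes` binds.
Lean: `(∃ c₀ : ℝ, ∀ c' : ℝ, c₀ ≤ c' →
Literature.NumberTheory.LFunctions.Zhang2022.KnifeEdge.InClassMean c') ∧ (∃ c₀ : ℝ, ∀ c' : ℝ, c₀ ≤
c' → Literature.NumberTheory.LFunctions.Zhang2022.KnifeEdge.GradedClosesPsi c')`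

## Assembly
Case split on the tree predicate `Skeleton.ForAllLarge (¬ AssumptionA)`: if (A) fails for all large
D, Theorem 1 is
`Skeleton.theorem1_of_eventually_not_assumptionA` (Zhang's Prop. 2.2(i)/Lemma 2.3 endgame, in the
tree); otherwise K1 supplies, for all
large c′, functionals X₁ Y₁ X₂ with the three ψ-graded tables and K2 (whose guard is exactly this
horn) supplies `GradedCloses X₁ Y₁ X₂`,
i.e. `KnifeEdge.GradedClosesPsi c'` for c′ ≥ max of the two thresholds; with K0 typer-1's
`KnifeEdge.theorem1_of_gradedClosesPsi_pack_eventually`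
(p485893; via `theorem1_of_gramSlots`, `Skeleton.prop22i_holds`, `lemma23_eventually`; axioms
propext/choice/Quot.sound, crit-1 02:18:09Z)
gives `Skeleton.Theorem1`. The deciding theorem `closes` (glue.lean, 12 lines) elaborates against
the tree (folder Sketch.lean rc 0). The
vacuous horn is harmless: under ForAllLarge ¬(A) every slot holds for any functional and
`gradedClosesPsi_of_notAEventually` (Pack Part 3,
p487378) gives the package, while Theorem 1 is already `theorem1_of_notAEventually` — `closes` takes
that exit first.
Fact-debt at closure (pin P-debt): conditional_bridge false; NO printed fact is a binder — K0 is the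
one derivation-debt (Zhang (8.23) for
general kinked pieces), K1 three new tables, K2 the sign; Part I of the manuscript (Prop. 2.2(i),
Lemma 2.3) is discharged in-tree.

CLOSES_TARGET: closes rung F-S3 of Parity: Literature.NumberTheory.LFunctions.Zhang2022.Skeleton.Theorem1 (D-0061; not the summit Statement) — the deciding theorem of this route concludes that registered leaf instead of the Statement decl `GeneralizedHardyLittlewood` (class rung: servable and labelled, never counted as concluding the summit Statement).

Rationale: WHY THIS LINE. Mechanism (card `z-degree-toeplitz-band`): grade Zhang's test vectors by powers of
the unit Z(ρ,ψ) (|Z(½+iγ,ψ)| = 1, tree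
`KnifeEdge.norm_Zpsi_eq_one_of`); the Gram table of a graded design then depends only on the degree
DIFFERENCE d (Toeplitz law,
`KnifeEdge.toeplitzLaw_holds`, `discPolar_zTwistW`), Zhang's own tables are d = 0, ±1, and the
Gauss-sum budget of 𝔠* makes |d| ≤ 2
recipe-evaluable and |d| ≥ 3 dark: the one new evaluable table is τ₂ (three-swap pattern a·m·n =
l₁l₂l₃, two χ-contractions ⇒ 𝔞𝔓
currency), and its side-3 vectors Z²·conj Q are degree-2 duals of divisor-class blocks at n ≍ q²/len
— length exponent θ ∈ (2−ν, 2),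
past the knife edge θ_max = 1 where every smooth/one-sided len design dies (cell KILL(len),
E-002/E-014). Imported from operator theory:
the Carathéodory–Toeplitz / Dym–Gohberg band-extension picture (singular principal block forces the
third row: `thirdRow_forced`,
`toeplitzKernelForcesTauTwo_holds`), which locates the closing test; imported from ℓ-adic/analytic
number theory for K1: Zhang's own
§7–8 conversion (reflection s' = 1 − s̄, exact expansion on σ = 3/2, ONE Gauss sum, reciprocity;
F2-conversion note) graded by Z^e —
the |d| = 2 table meets the family Gauss moment Σ_{ψ≠ψ₀} τ(ψ̄)³ψ(m)ψ̄(n) = (p−1)Kl₃(m n̄;p) + 1,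
i.e. bilinear forms in hyper-Kloosterman
sums to PRIME moduli (KowalskiMichelSawin2017, Katz1988) instead of divisor functions in
progressions. Sources: Zhang2022LandauSiegel
§2 (2.16)–(2.17), §7 Prop 7.1, §8 Lemma 8.1/(8.5)/(8.23); KowalskiMichelSawin2017 Thms 1.1/1.3;
arXiv:1304.3199 (d₃ level 1/2+1/46,
the wrong face); tree files KnifeEdgeLenZDegree{,Psi,Dark,Closed,Barrier,Pack}.lean (typer-1 g3, 14
accepted proposals). No prior
route of this sub uses Zhang's discrete mean at all except the manuscript-repair lines (cell §B,
Margin232 dead) and the len/ell/fam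
births; none grades test vectors by the root number, and the negatives index has no statement on
`zDegMeanPsi`/`GradedCloses`.

RANKED CRUXES. #2 PsiGradedTables (crux) — K1 (EXISTENCE; the card's K1″ lives here). For all large
c′ there are pair functionals X₁^ψ, Y₁^ψ, X₂^ψ such that, under (A) and eventually in D, for
in-class profiles: τ₁^ψ(conj Q_g, H_f) = X₁(f,g)·𝔞𝔓 + o(𝔞𝔓), τ₁^ψ(conj Q_{g₂}, conj Q_{g₁}) =
Y₁(g₁,g₂)·𝔞𝔓 + o(𝔞𝔓), and the NEW table τ₂^ψ(conj Q_g, H_f) = X₂(f,g)·𝔞𝔓 + o(𝔞𝔓) (τ_d^ψ =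
`zDegMeanPsi c' χ d`, Zhang lengths ⌊P⌋+1). In Zhang's bookkeeping (F2 note, graded Lemma 8.1):
entry_d = Θ^{(d)} + conj Θ^{(−d)}, the e ≥ 2 half is o(𝔓) on σ = 3/2, and the |d| = 2 half is a
Kl₃-correlation: X₂ = a bilinear form (μ∗χb)_r ⊗ (d₃)_h coupled by h·n ≡ r (mod p), h ∈ ℤ∖{0} SIGNED
(the ψ(−1) of τ(ψ)³τ(ψ̄)³ = ψ(−1)p³ cancels against the three Poisson/Voronoi signs only with both
signs of h; crit-1 02:33:19Z (3)); X₂^{diag} = the family h·n = r (= the recipe class a·m·n =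
l₁l₂l₃, live at order 𝔞𝔓 by the R1 census); X₂ exists iff the wrap h·n ≡ r, h·n ≠ r cancels or
converges. Census-level evidence, not an item: `KnifeEdge.TauTwoLivePsiZhang` (τ₂ ≫ 𝔞𝔓 on flat
data). DECIDING typed crux (director's K1″); typed split in tree: `CrossMeanSplit c' 2 Tdiag Twrap`
∧ `DiagMain Tdiag X₂` (K1″a) ∧ `WrapNegligible Twrap` (K1″b) ⇒ `TauTwoTablePsi c' X₂`
(`tauTwoTablePsi_of_split`, p487998; `familyGaussMoment_holds` PROVED there). In-print inputs typed
by name (p488591/p489270/p489072): `kowalskiMichelSawin2017_theorem11_hyper` / `_theorem13_hyper` (k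
= 3 boxes), `FKM2014.fouvryKowalskiMichel2014_theorem17_hyper` (W-r face: μ against Kl₃, power
saving from X ≈ p^{3/4}), `deligne_hyperKloosterman_bound`; Pólya–Vinogradov-range completion covers
N ≥ p^{1/2+ε}. Load-bearing obstruction as read by crit-1 (4): not a missing box but the
Cauchy–Schwarz loss in the class variable — dispersion beyond ℓ² for (μ∗χb) ⊗ d₃ coupled by h·n ≡ r
(p). [difficulty: L] (why it might fail: X₂ needs the |d|=2 wrap-around — a bilinear Kl₃ form to
prime moduli p∼P with a μ∗χb variable of length up to P⁴ — to cancel or converge; in print only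
box-wise (KMS 2017 Thms 1.1/1.3, Voronoi, BV); a non-convergent wrap means no X₂ and the slot is
false.) [Zhang2022LandauSiegel, KowalskiMichelSawin2017, Katz1988, arXiv:1304.3199, arXiv:1211.6043,
arXiv:1802.09849, p484034, p487998, p488591, p489072]
#3 PsiGradedTablesClose (crux, stmt-Parity-20015) — K2 (SIGN) ON THE WIDE CLASS; binder h2 of
`closes` at revs 0–12, SUPERSEDED AS BINDER at rev 13 (WAKE R2) by #3′ `PsiGradedTablesClosePoly`
(which implies it: restrict the full tables to 𝒞 by `.on`, forget the class by
`GradedClosesOn.gradedCloses` — tenure Sketch `psiGradedTablesClose_of_poly`, rc 0); stays DECLARED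
as the split parent of 20429/20430/20431 (half-class experiment of record, HOLD-20430) — outside the
deciding cone, not a prover target. If (A)-characters recur (¬ ForAllLarge ¬(A)), then for all large
c′ and ALL pair functionals X₁, Y₁, X₂ satisfying the three ψ-graded tables at c′ (degree-1 cross
`CrossTablePsi c' 1 X₁`, degree-1 dual `DualCrossTablePsi c' 1 Y₁`, degree-2 `TauTwoTablePsi c'
X₂`), the graded 3×3 main-term matrix [[𝔅f, X̄₁, X̄₂],[X₁, 𝔅g₁, Ȳ₁],[X₂, Y₁, 𝔅g₂]] fails PSD on some
in-class design (`GradedCloses X₁ Y₁ X₂`). The tables pin X on in-class pieces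
(`crossTablePsi_unique`), so this is the closing condition for THE functionals, not for unnamed ones
(critic pin P-X, option β split; not option γ). Dichotomy of record: exactly one of
`GradedCloses`/`GradedPSD` (`gradedCloses_or_gradedPSD`, p485449); X₂ = 0 horn = Schur test |X₁|²/𝔅f
+ |Y₁|²/𝔅g₂ > 𝔅g₁ (`gradedClosesPsi_of_schur_dark`). STATUS (crit-1 kernel finding): GLUE-FACING,
not the deciding crux — given K0 ∧ K1 it is ⟺ ForAllLarge ¬(A)
(`gradedClosesPsi_iff_notAEventually_closed`; T1 line by name `theorem1_or_witnesses_agree`,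
p489386); its kernel form is α3 `GradedCloses X₁psi Y₁psi X₂psi` for the explicit defs α1 ((A)-free
real analysis, decidable), reached through the birth skeleton's `stub_candidatesClose` (= α2 ∧ α3 by
construction) + `stub_transfer` (uniqueness on this horn). [deps: PsiGradedTables] [difficulty: L]
(why it might fail: LIKELY PRODUCT is the other horn `GradedPSD` (graded B-AH⁺): X₂^{diag} is
model-consistent, the Kl₃ wrap must cancel, no (A)-independent biased source is located (ref-1:
ANSWERED-NULL) — then the tables are PSD at main order and nothing closes.) [Zhang2022LandauSiegel,
KowalskiMichelSawin2017, p485449, p485599, p485893, p489549, p489386]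
#3′ PsiGradedTablesClosePoly (crux, rank 3; h2′ = K2 OF RECORD from rev 13, binder h2 of `closes`) —
K2 ON A POLYNOMIAL CLASS. If (A)-characters recur, THERE IS a class 𝒞 of pairs of POLYNOMIAL PIECES
OF SUB-UNIT LENGTH — class bound PER PIECE, verbatim the `_poly` glue's h𝒞 «(∃ θ < 1, PolyShortPiece
θ f f′) ∧ (∃ θ < 1, PolyShortPiece θ g g′)» (NOT `𝒞 ⊆ PolyShortPairs`, which admits θ_f = 1: E-G5-5,
crit-1 18:21:36Z (C1)); LONG pairs θ_f + θ_g ≥ 1 admitted — such that for all large c′, ALL pair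
functionals X₁, Y₁, X₂ satisfying the three ψ-graded tables ON 𝒞 (`CrossTablePsiOn c′ 𝒞 1 X₁`,
`DualCrossTablePsiOn c′ 𝒞 1 Y₁`, `CrossTablePsiOn c′ 𝒞 2 X₂`; pinned there,
`crossTablePsiOn_unique`) close on an in-class design whose three pairs lie in 𝒞 (`GradedClosesOn 𝒞
X₁ Y₁ X₂`, p521869). TYPING CHECKS (tenure Sketch rc 0 / BC7 probe VERDICT CLEAN): 𝒞 = ∅ is no
witness (`GradedClosesOn ⊥` false); monotone in 𝒞 (`.mono` + weakening), so `∃ 𝒞` ≡ the maximal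
sub-unit poly class up to the threshold; the `∀ 𝒞` form is false (singleton classes) and is not
filed. SUPPLIER NAMED (WAKE R2 (ii)) = (a): the SIGN TEST ON POLYNOMIAL DESIGNS with every piece of
explicit length θ < 1. LIVE SUB-LINE = LONG poly pairs: x₁/y₁ there are the long-leg χ-window slots
`Slot.FormulaILongPsiDil` / `FormulaILongDualDil` / `Lemma81LongPsiDil` / `LegSplitTransferX2Dil`
(KnifeEdgeLenLongLegChiWindow, p564811/p567123 — LINES on 20446 under D-0145, not items), the 𝒳₂
object 20446 `LongPairsGradedTables` and its registered skeleton
`Cruxes/LongPairsGradedTables/Lines/explicit_twins.lean` (explicit twins 20031/20032 restricted to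
poly designs, e.g. lengths (0.9, 0.9, 0.9)). TYPED NULL (do NOT work): the SHORT poly sub-case — x₁,
y₁, x₂ are desk-dark on short pairs (DISPLAYS #1–#3, ports p539927/p540220/p540218 = items
20429/20444/20445), so Schur needs 𝔅(g₁) < 0, excluded by `mainTermForm_nonneg[_of_isH1]`
(HOLD-20430; `Theorems.shortPairsSchurClose_iff_notAEventually_of_dark`, p531342). Fallback (b)
density transfer `gradedClosesOn_poly_of_short` NOT filed (price: continuity of the closed forms
along `exists_polyShortPairs_approx` + a wide-K0 a-priori bound; unnecessary when the design is born
polynomial). [deps: PsiGradedTables] [difficulty: L] (why it might fail: if the degree-1/2 cells are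
dark or PSD-completing on LONG sub-unit poly pairs too (X2-HOLD «wrap-or-dark», DISPLAY #6 F1), no
poly class closes and under recurrence the item is FALSE — the graded B-AH⁺ horn on the poly class.)
[Zhang2022LandauSiegel §7–§9, KowalskiMichelSawin2017, p521869, p555689, p564811, p567123, p531342,
p485449]
#4 InClassSideTablesPiece (crux, stmt-Parity-20459; K0 of record revs 7–12 = binder h0; from rev 13
OUTSIDE THE DECIDING CONE — h0 of `closes` is #4′ `InClassSideTablesPoly`; 20459 stays OPEN and
DECLARED: verdict RESTATE (K0-p1 g2: wider than proved — poly/C² short pieces are kernel — and wider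
than consumed — designs are born polynomial), crit-1 class facts F1–F3 20:35:31Z (H¹-type,
wall-reaching θ = 1 members, pointwise binder); K0-p1 g3 lands the kinked-short / H¹-short classes
as Literature leaves `--supports 20459`; 20459 ⇒ #4′ by
`KnifeEdge.inClassMeanPoly_eventually_of_inClassMeanPiece`) — K0 (SIDE TABLES; critic pin P-debt =
derivation debt, never the lever). ∃ c₀ ∀ c′ ≥ c₀, `KnifeEdge.InClassMeanPiece c′`
(KnifeEdgeLenZDegreeK0Piece :75, p535985): under (A), eventually in D, Σ𝔠*|H_u(ρ,ψ)|²ω = 𝔅(u)·𝔞𝔓 +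
o(𝔞𝔓) for every in-class PIECE (`InClassPiece u u′`: H¹ profile on [0,1], kinks allowed, u = u′ = 0
on [1,∞) — the wall condition the original item 20016 `InClassSideTables` lacked: u ≡ 1 was
admissible there, making it ⟺ ForAllLarge ¬(A); 20016 SETTLED MISSTATED-AS-TYPED (K0-MISSTATED.md
9d6c912d0fab6a8c; kernels `kinkedProfile_const` / `mainTermForm_const_one` /
`not_inClassPiece_const_one`, p535985) and DROPPED at rev 9; its decl survives only as a retired
negative edge). Zhang prints (8.23) for his H₁ (`Skeleton.Eval823`); for a general piece it is a
derivation through Prop 7.1 + §8. LINE OF RECORD «sjrows» (ls-knife-K0-p1 g0; registered skeleton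
`Cruxes/InClassSideTablesPiece/Lines/sjrows.lean` sha16 c7665c8442d469d3 + card `Lines/sjrows.md`,
published by this tenure at rev 9): K0 ⇐ S1 `stub_sjRows` (rows (S): α⁻¹S_j(𝐚_u, conj 𝐚_u) = 𝔪_j(u)𝔞
+ o(𝔞), j = 1,2,3, for every SHORT in-class piece θ < 1 — `KnifeEdge.SjProfileRow`, the §8 number
theory = LEMMA A (Lemma 8.2 with a general C²/pw-C² ψ-side weight, by superposition) + LEMMA A*
(Lemmas 8.3/8.4) gathered by (8.10); HARDEST and the only STAFFED stub; C² short pieces near kernel: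
p549083/p550073/p550974/p551441/p551672 ACCEPTED, `sjProfileRow_C2` compiling; kinks (K) and the
rough-H¹ tail by density next) ∧ S2 `stub_sliver` (`InClassMeanShort c′ → InClassMeanPiece c′`:
formula I on the wall sliver ⌈PT⁻²⌉ ≤ n ≤ P of a FULL-length piece, outside the tree's Prop 7.1
support `Nsupp`) → K0 by the LANDED reduction `KnifeEdge.inClassMeanShort_of_sjRows` (K0Short
p537807 :451; (S) ⇒ (M),(E), Prop 7.1, Lemma 8.1, Prop 2.2(i), Lemma 2.3 all discharged). PLACEMENT
OF S2 (tenure act, ls-lead WORDS #14 (2)(c); theory 15:26:24Z «K0-wall = a K-len line, one class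
with Leg A ‹ψ-side length beyond PT⁻²› ((7.19)–(7.20)), never routine; S2-avoidance = the
successor's call»; crit-1 14:38:44Z STRUCTURAL REMARK): SHORT-K0 — `stub_sliver` is NOT LOAD-BEARING
BY INTENT and UNSTAFFED. Reasons: K0 enters `closes` only at the three DIAGONAL Gram entries of the
closing triple (`gramEntryAsymp_psi_diag_piece h0`, K0Piece :177/:181/:185 and :267/:271/:275; h0 is
applied at the witness of `GradedCloses[PsiOn]` :205/:227/:294 and nowhere else; the density leg and
the short ports p538281 Part 1 use K0 on SHORT pieces only); the (a)-branch closing witnesses (K2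
via 20430 `ShortPairsSchurClose`) are short PAIRS hence short PIECES automatically
(`KnifeEdge.ShortPairs`, KnifeEdgeLenZDegreeShort :157: θf + θg < 1); on the live lever 20446 (long
pairs) both pieces may still be short, and a strict closure at a full-length triple persists under
dilation u ↦ u(·/θ), θ → 1⁻ whenever the off-diagonal tables are continuous under dilation
(automatic for the closed-form twins 20031/20032; one named hypothesis for abstract long-pair
functionals); so the generality S2 buys is the corner θ = 1 alone, at the price of a len knife-edge
instance inside the derivation debt. Nothing new is filed (WORDS #14 (2)(c)); 20459 stays binder h0
of `closes`; the re-pose package and its trigger are under NOT DECOMPOSED YET; theory's KNIFE-EDGES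
§4 may keep «K0-wall» as an UNSTAFFED K-len line of the Leg-A class OUTSIDE this route's intended
cone. [difficulty: M–L for S1; S2 = K-len class, unstaffed] (why it might fail: rows (S) are Zhang's
§8 computation with a general weight — fails as typed if `InClassPiece` admits rough H¹ pieces whose
ψ-side Riesz means do not converge at the o(𝔞) scale (repair: narrow to piecewise-C²), or, for
FULL-length pieces, if formula I on the sliver (PT⁻², P] needs Prop 7.1 past (7.19)–(7.20) — the len
knife edge; the SHORT-K0 re-pose removes the second failure mode from the cone.)
[Zhang2022LandauSiegel §7 Prop 7.1 (7.5)/(7.15)/(7.19)–(7.20), §8 Lemmas 8.1–8.4/(8.10)/(8.23);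
p535985, p537807, p539785–p546550 (Section8Dipole* engines), p549083, p550073, p550974, p551441,
p551672; K0-MISSTATED.md 9d6c912d0fab6a8c; SJROWS-STATE.md 88a5d89c37c9d95d]
#4′ InClassSideTablesPoly (support, rank 4; h0′ = K0 OF RECORD from rev 13, binder h0 of `closes`) —
THE SIDE TABLES ON POLYNOMIAL SHORT PIECES: ∃ c₀ ∀ c′ ≥ c₀, `KnifeEdge.InClassMeanPoly c′`
(KnifeEdgeLenZDegreeK0Poly p555689: for every θ < 1, every `PolyShortPiece θ u u′` and every ε > 0,
ForAllLarge (AssumptionA → |discMean c′ χ (profPoly χ · u (⌊P⌋+1)) − 𝔅(u)·𝔞𝔓| ≤ ε𝔞𝔓)). KERNEL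
ALREADY: `DipoleRule.inClassMeanPoly_eventually` (Section8ProfileSjPoly p558282, K0-p1 g2; rows (S)
for polynomial pieces by the LEMMA A/A* dipole engines p539785–p557827 + the (S) ⇒ K0 reduction);
the item's closing file is one line (tenure Sketch `inClassSideTablesPoly_proof`, rc 0) and is K0-p1
g3's to land. Filed as SUPPORT, not crux: a statement with a kernel proof has no why-might-fail.
ROLE: h0 is consumed by `theorem1_of_gradedClosesPsiOn_pack_eventually_poly` at the three DIAGONAL
Gram entries of the closing design only, each piece a `PolyShortPiece θ`, θ < 1, by #3′'s class
bound — so the books read «poly K0 closes ITEM h0′; ROUTE closure waits on h2′». [difficulty: S]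
[Zhang2022LandauSiegel §7 Prop 7.1, §8 (8.10)/(8.23); p555689, p558282, p557827, p537807]

TWO-LAYER PLAN. K1 ⇐ (degree-1 cross table: ∃ X₁, eventually `CrossTablePsi c' 1 X₁`) → (degree-1
dual table: ∃ Y₁) → (degree-2 table: ∃ X₂, `TauTwoTablePsi`) → K1
(thresholds maxed; birth skeleton `bc/PsiGradedTables_birth.lean`, stubs `stub_crossPsi`,
`stub_dualPsi`, `stub_tauTwoSplit` — the last is
the card's K1″ in the tree's typed split `CrossMeanSplit c' 2` ∧ `DiagMain` ∧ `WrapNegligible` →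
`TauTwoTablePsi` (`tauTwoTablePsi_of_split`):
K1″a «X₂^{diag} formula» (Zhang-type main-term calculus, L) + K1″b «X₂^{wrap} = o(𝔞𝔓)» (bilinear Kl₃
to prime moduli over all boxes g·r ≲ P⁴: Poisson/Voronoi for g > p, Bombieri–Vinogradov for r > P²,
KowalskiMichelSawin2017 Thms 1.1/1.3
for g, r ∈ (p^{1/2}, p^{5/4}); the boxes {g < p^{1/2}, p < r < P²} are where XL may re-enter)). K2 ⇐
(closed-form candidates X₁⁰ Y₁⁰ X₂⁰
satisfying the tables AND `GradedCloses X₁⁰ Y₁⁰ X₂⁰` — items α1 + α2 + α3 below by construction; α3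
is decidable real analysis once α1 exists)
→ (transfer: two functionals satisfying the same tables agree on in-class pieces on the
(A)-recurrent horn, tree `crossTablePsi_unique`
/ `dualCrossTablePsi_unique`, so `GradedCloses` transfers) → K2 (birth skeleton
`bc/PsiGradedTablesClose_birth.lean`). K0 (20459) ⇐ line «sjrows»:
`stub_sjRows` (rows (S) on short in-class pieces) ∧ `stub_sliver` (wall sliver; PLACED SHORT-K0 =
not load-bearing by intent, unstaffed) → K0 via `KnifeEdge.inClassMeanShort_of_sjRows` (registered
skeleton Lines/sjrows.lean c7665c8442d469d3, `InClassSideTablesPiece_of` kernel-checked modulo the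
two stubs).
FILED SO FAR (glued splits, gens 0–1): K1 20014 → 20444 `ShortPairsCrossDegOne` (support) + 20445
`ShortPairsDualDegOne` (support) + 20446 `LongPairsGradedTables` (crux, the live lever; HELD pending
F1/F2) with glue 20447 `PsiGradedTablesOfClasses` CLOSED (p530142); K2 20015 → 20429
`ShortPairsTauTwoDark` (support) + 20430 `ShortPairsSchurClose` (crux, kill path; HELD) with glue
20431 `PsiGradedTablesCloseOfShort` CLOSED (p529406); explicit twins 20031 `PsiDegOneSlotsExplicit`
(support, HELD) / 20032 `TauTwoSlotExplicit` (crux r2, HELD) / 20033 `GradedClosesExplicit`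
(support, unsigned by design). Nothing further filed at revs 9–11. REV 12/13 (WAKE R2, tenure g3):
FILED h0′ `InClassSideTablesPoly` (support r4) + h2′ `PsiGradedTablesClosePoly` (crux r3), imports
+= KnifeEdgeLenZDegreeK0Poly, and `closes` RE-KEYED to (h0 : InClassSideTablesPoly) (h1 :
PsiGradedTables) (h2 : PsiGradedTablesClosePoly) through
`KnifeEdge.theorem1_of_gradedClosesPsiOn_pack_eventually_poly` (h1 restricted to h2′'s class by
`CrossTablePsi.on` / `DualCrossTablePsi.on`; certified `route check --native --id` before the edit).
K2′ ⇐ (explicit long-leg slots on poly designs: the χ-window closed forms x₁/y₁ of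
KnifeEdgeLenLongLegChiWindow + x₂|poly) → (sign of the graded 3×3 form on ONE poly triple, decidable
real analysis once the slots are explicit) → (transfer by `crossTablePsiOn_unique`) → K2′ — children
NOT filed until a slot closes (planner rule); the 20015 split family (20429/20430/20431) is the
typed record of the half-class experiment and stays as declared.

KILL CRITERIA. Director's pricing of record (01:42:55Z, verbatim): «K1″ = L (XL if X₂^{wrap} is
needed pointwise) = the deciding crux; K2 = M–L with the
LIKELY PRODUCT the barrier branch (a graded B-AH⁺ theorem) — so the honest expected outcome is a
FRONTIER route whose first theorem may be a
barrier». Refuted outright (close --reason refuted:PsiGradedTablesClose): a theorem `(¬ ForAllLarge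
¬(A)) → ∀ large c′, ∀ X₁ Y₁ X₂ with the
tables, GradedPSD X₁ Y₁ X₂` — the graded B-AH⁺ barrier for the true functionals (typed horn
`KnifeEdge.GradedPSD`, p485449); that theorem IS
the route's expected first product and is banked as a barrier (Literature/Barriers candidate
«root-number grading does not escape B-AH»); its
KERNEL FORM is `GradedPSD X₁psi Y₁psi X₂psi` for the explicit defs α1 (crit-1 P-formula: the
∃-package itself can never be refuted outright,
`gradedClosesPsi_of_notAEventually`), i.e. refuted:α3. FORK ORDER (crit-1 02:33:19Z (5)): the route
tests the FORMULA-LEVEL fork first — α1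
defs → ls-ref-1's ALPHA3-CELL v0.3 (S1 model-side twin on every slot, then an interval-certified
λ_min cell, one kit job --tag sz) → α3 or its
twin; the STRUCTURAL fork («GradedPSD of the true functionals as a corollary of a pointwise
positivity of Re 𝔠*·ω» = E-014 in global form) is
NOT automatic (crit-1 02:44:00Z (ii): the on-span premise stops at n ≤ P^{1+ε₀}, far below the d = 2
table's m ≲ P⁴) and is ls-barrier-plan's
question; if it lands first it closes this route refuted:α3 at S–M cost.
Refuted:PsiGradedTables (no functional X₂: the Kl₃ wrap neither cancels nor converges) kills the
card's lever itself — no pivot inside this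
route (a D-dependent or oscillating X₂ is a different thesis). K0 record: 20016 `InClassSideTables`
SETTLED MISSTATED-AS-TYPED and DROPPED (rev 9); Refuted:InClassSideTablesPiece ⇒ class misstated
again, located by the witness — a FULL-length (sliver) pathology ⇒ repair = the SHORT-K0 re-pose
(NOT DECOMPOSED YET (v)); rows (S) failing for a rough-H¹/kinked piece ⇒ narrow `InClassPiece` to
Zhang's piecewise-C² pieces; restate by REPAIR-DUTY mechanics (new item + re-certified glue), not
pivot — K0 is derivation debt and cannot kill the line. Refuted:PsiGradedTablesClosePoly (rev 13
binder h2′): under recurrence NO sub-unit poly class closes = the degree-1/2 cells are dark or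
PSD-completing on long poly pairs too — the graded B-AH⁺ horn ON THE POLY CLASS, banked exactly as
refuted:PsiGradedTablesClose; the route then has no closing design class left short of wall-reaching
(θ = 1) designs, which need the wide K0 (20459 incl. `stub_sliver`, the len knife edge) — close
`refuted:PsiGradedTablesClosePoly` unless 20459 is kernel by then (then re-key h0/h2 back to the
wide pair by REPAIR-DUTY mechanics). Mooted if `Skeleton.Theorem1` lands through cell §B (manuscript
repair), births
(2)/(3), or any other line. CIRCULARITY CERTIFICATE: K2 is stated on the (A)-recurrent horn only; a
proof of K2 that goes through
«(A) eventually false» is not available (the guard is its negation), and a proof of `PsiGradedTables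
→ Theorem1` without K2 closes this route
reduces-to (K1 would then carry the summit alone — no mechanism for that is claimed).

NOT DECOMPOSED YET. FILED RIGHT AFTER OPEN as INFORMAL ledger items (crit-1 C0 REQUIREMENT
02:52:02Z/02:53:24Z; `ledger workitem add … --route <id>`, exact
commands in the packet's BC-RECORD; signatures by `set-signature` once the archimedean census pins
the formulas): α1 (definition, FIRST typed
deliverable) «closed-form `X₁psi Y₁psi X₂psiDiag : KnifeEdge.PairFunctional` per F2 note §3 + census
— genuine sesquilinear profile integrals,
zero profile ↦ 0 on every leg (junk guard: `inClassPiece_zero`, crit-1 ZDegJunk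
`gradedCloses_of_junk_table`)»; α2-deg1 (statement, rank 5, M–L)
«`CrossTablePsi c' 1 X₁psi` ∧ `DualCrossTablePsi c' 1 Y₁psi` eventually in c′»; α2-deg2 (statement,
rank 2 twin of K1, L–XL) «`TauTwoTablePsi c'
X₂psi` via `CrossMeanSplit c' 2`/`DiagMain` (K1″a)/`WrapNegligible` (K1″b)»; α3 (statement, rank 3,
M) «`GradedCloses X₁psi Y₁psi X₂psi` — (A)-free
calculus; barrier twin `GradedPSD X₁psi Y₁psi X₂psi`; cell ALPHA3-CELL v0.3 (ls-ref-1)». Typed K1/K2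
then follow from α-items by `∃`-introduction
and `stub_transfer`. Still layer 2: the box-by-box treatment of the wrap (K1″b children); the
kinked-piece dictionary lemmas behind K0. K3 of the card (`ZDegreeDarkInWall`, exhaustion: |d| ≥ 3
dark
in-wall) is context for the NEXT route (band exhaustion), not an item here. (v) SHORT-K0 RE-POSE
PACKAGE — EXECUTED at revs 12/13 IN ITS POLYNOMIAL FORM (WAKE R2; the kernel delivered
`InClassMeanPoly`, not `InClassMeanShort`: h0′ = `InClassSideTablesPoly`, h2′ =
`PsiGradedTablesClosePoly`, glue `_poly`; see RANKED CRUXES #3′/#4′); the rev-9 text of the package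
is kept below as the record of the decision (read `Poly` for `Short`). Original text: (tenure
decision rev 9; NOT filed then — WORDS #14 (2)(c) «file nothing new», planner rule «no further
decomposition until a crux closes»). TRIGGER: `stub_sjRows` a kernel theorem on the piece class the
closing designs use (C² first, then kinks) OR a K2-side line first needing K0 at a closing witness.
ACTS (REPAIR-DUTY mechanics as rev 7's K0 repair: one `workitem add` + one `route edit
--closes-file`, binders h1/h2 of record otherwise unchanged): (i) item `InClassSideTablesShort := ∃
c₀ : ℝ, ∀ c′ : ℝ, c₀ ≤ c′ → KnifeEdge.InClassMeanShort c′` (K0Short :216; closes from `stub_sjRows`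
by `inClassMeanShort_of_sjRows` in one line); (ii) §D typer ask: the SHORT closes chain = K0Piece
Part 3 re-threaded over `InClassMeanShort` with pair class 𝒞 ∧ «both pieces short» (shape
`theorem1_of_gradedClosesPsiOn_pack_eventually_short`, S-sized: h0 is consumed at the 𝒞-witness
diagonal only) + `_short` twins of the short ports' `hd` binders (p538281/p539927/p540220/p540218
apply K0 to short pieces only); (iii) re-glue `closes (h0 : InClassSideTablesShort) (h1 :
PsiGradedTables) (h2′)` with h2′ = K2 whose closing witness is sought among short-piece triples (new
item, same mechanics; the (a)-branch children 20429/20430 already live on `ShortPairs`); (iv)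
`--drop` 20459 or keep it as the banked stronger statement. REVERSAL: a kernel display of formula I
on the sliver at cost ≤ M (e.g. a corollary of a Leg-A theorem past (7.19)–(7.20)) flips the
placement back to «prove stub_sliver», no edit needed; if Leg A is displayed, K0-wall falls with it
and (i)–(iv) are moot.

CHEAPEST FALSIFIER. (i) X₂^ψ ≡ 0 on in-class pieces would reduce K2 to the X₂ = 0 Schur test, which
the positive model kills (Y₁ = 0 on kernel pairs,
`dualTable_eq_zero_of_gradedPSD_dark`; 2×2 B-AH `norm_sq_mainTermFormPolar_le`) — so the cheapest
kill of the LINE is «the exact class of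
τ₂ is empty / lower order». RAN (R1 §2 census, symbolic; F2 note §3): with unit Z(ρ,ψ) and Zhang's
χψ data the class a·m·n = l₁l₂l₃ is
non-empty with two χ-contractions, order 𝔞𝔓 — alive (the v2 unit Z(ρ,χψ) version WAS empty, D²∣a,
conceded in R1 §0). (ii) The decisive
cell for the §D engines (crit-1 C0-prep §7): once X₁^ψ, Y₁^ψ, X₂^ψ are explicit profile integrals,
minimise the 3×3 graded form over kinked
in-class (f, g₁, g₂) and amplitudes s (float scan, then interval certificate at the minimiser; kit
--tag sz): min ≥ 0 ⇒ barrier branch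
indicated; min < 0 ⇒ contradiction candidate. NOT runnable tonight — the formulas are K1's
deliverable; no kit job is claimed. (iii) For h2′ (rev 13): DISPLAY #6 F1 = the (A)-class mean of
the long-leg cell on ONE long poly pair (lengths 0.9/0.9): F1 dark (or the 3×3 form PSD at the
explicit slots on the (0.9, 0.9, 0.9) triple) ⇒ h2′ false under recurrence ⇒ close
refuted:PsiGradedTablesClosePoly; F1 live with |x₁|²/𝔅f + |y₁|²/𝔅g₂ > 𝔅g₁ at some poly triple ⇒
contradiction candidate (then the explicit-twin children are filed). Desk-runnable by ls-ref-1 once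
`Slot.FormulaILongPsiDil` has its closed form; no kit job claimed by the tenure.

NUMBERS. Knife edge θ_max = 1 (cell KILL(len)); side-3 length exponent θ ∈ (2−ν, 2), ν < 1/2
strictly (card v3.1). Currency: all three new
tables at order 𝔞𝔓 (two χ-contractions; R1 §2). Trivial bound for the |d| = 2 entry per prime: ≪
p²t₀³ against main terms ≍ p (Deligne
|Kl₃| ≤ 3p), so a power of p must cancel (F2 §3). In-print bilinear Kl_k ranges
(KowalskiMichelSawin2017 Thm 1.1: 1 ≤ M ≤ Nq^{1/4},
q^{1/4} < MN < q^{5/4}, non-trivial at M = N ≥ q^{11/24}; Thm 1.3: M ≤ N², N < q, MN < q^{3/2}); d₃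
in APs: level 1/2 + 1/46 pointwise
(arXiv:1304.3199), 2/3 on ℓ²-average over classes at a prime (the B-len ladder LOD-LADDER-len v1.1).
c′ enters only via β_j = O(c′α𝓛·α)
with c′α𝓛 = πc′𝓛⁻⁸ → 0 (Zhang (2.6)/(2.10)/(2.13); crit-1 T6 resolved), so the eventually-in-c′ item
shape is not misstated-strong.
Theorem 1's exponent 2022 is the leaf's; the route proves no intermediate L(1,χ) bound.

DEFINITION REQUESTS. None at open: every constant is in the tree (`KnifeEdge.InClassMean`,
`CrossTablePsi`, `DualCrossTablePsi`, `TauTwoTablePsi`, `GradedCloses`,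
`GradedClosesPsi`, `GradedPSD`, `PairFunctional`, `Skeleton.ForAllLarge/AssumptionA/Theorem1`). Item
α1 (definition, filed informally right after open; typer-1 g4 writes it on
the author's/successor's ask once K1″a pins the archimedean weights): closed-form `def X₁psi Y₁psi
X₂psiDiag : KnifeEdge.PairFunctional`
(sesquilinear, zero profile ↦ 0). Already in tree since the card:
`KnifeEdgeLenZDegree.FamilyGaussMoment` + `familyGaussMoment_holds` (PROVED),
`GradedLemma81` / `ThetaGradedNegligible` (OPEN Props), `CrossMeanSplit`/`DiagMain`/`WrapNegligible`
(p487998).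

Novelty: Searches (2026-08-26/27, this lineage g0–g3): lit search --hybrid "root number twisted test vectors
positivity discrete mean Landau-Siegel" (0 relevant; Zhang 2211.02515 itself, Conrey–Iwaniec spacing
papers); lit search "Caratheodory Toeplitz band extension positive definite completion" (Dym–Gohberg
1981, Grone–Johnson–Sá–Wolkowicz 1984 — operator theory, no L-function use); lit search --hybrid
"bilinear forms hyper-Kloosterman sums prime moduli below Polya-Vinogradov" (held:
[corpus:paper:arxiv-1511.01636 p3] KMS Thms 1.1/1.3; citing 2204.05038, 2111.07311, 2304.08231); lit
galaxy search "Bilinear forms with Kloosterman sums" --star pdf ([galaxy:pdf:6628697523578397840]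
Shparlinski–Zhang 1601.05123; [galaxy:pdf:2718093120] Michel AWS notes); lit galaxy search
"Landau-Siegel|discrete mean" --star all (Zhang only); lean search 'zDegMean|GradedCloses|TauTwo'
(tree: typer-1's files only); ledger negatives --problem Parity (no statement on zDegMeanPsi /
GradedCloses / CrossTablePsi).
Nearest prior art found: Zhang2022LandauSiegel §2 (the d = 0, ±1 tables and the 2-vector positivity
argument); the cell's own E*-len⁺ / E-002 two-piece closing (dead in class: B-AH, KILL(len));
Conrey–Iwaniec-type discrete means over zeros (no grading); Dym–Gohberg band extension (the imported
engine); KowalskiMichelSawin2017 (the tool K1″b needs).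
Delta: nobody has graded the test vectors of a zero-detecting positivity argument by powers of the
root number — the grading turns the Gram table Toeplit  [refs: paper:arxiv-1511.01636, KowalskiMichelSawin2017]

Barriers (technique_class: positivity-gram, root-number-grading, toeplitz-band, Kl3): - technique_class: positivity-gram, root-number-grading, toeplitz-band, Kl3
- Literature.Barriers.Parity.LargeSieveLevelHalf: K1″b (the wrap) is INSIDE the genre «bilinear
forms to moduli ∼ P with lengths ≷ P» but does not ask for a level of distribution past 1/2 of a
divisor function: it asks for cancellation in bilinear Kl₃ forms at PRIME moduli, where completion +
Deligne + KMS-type arguments work below the Pólya–Vinogradov range; the barrier theorem quantifies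
over large-sieve constants for characters and does not reach trace-function bilinear forms — evasion
by hypothesis «prime modulus, trace weight», bet: the populated boxes are KMS/Voronoi/BV-covered.
- Literature.Barriers.Parity.SelbergParityBarrier: not in the technique class (no sieve weights; μ
enters only through the exact expansion of 1/L(s,ψ) on σ = 3/2, summed with absolute convergence) —
does not apply.
- Literature.Barriers.Parity.BrunTitchmarshSiegelZero: same genre in spirit (an (A)-world
computation must produce a sign contradiction); the cell's typed form of this obstruction for len
designs is B-AH (`norm_sq_mainTermFormPolar_le`: the 2×2 main-term matrix is PSD in class) and
KILL(len) θ_max = 1; the route evades by a THIRD vector whose table (τ₂) is not a 2×2 Cauchy–Schwarz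
quantity and whose dual length is θ ∈ (2−ν,2); it does NOT evade the graded analogue B-AH⁺
(`GradedPSD`) — the bet is that X₂^ψ is live and large enough against (𝔅f𝔅g₂)^{1/2} on some kinked
design, and the honest expectation (directo

Novelty grade: new-mechanism — critic: MIRROR of the sticky card verdict z-degree-toeplitz-band (ls-knife-crit-1 g2 2026-08-27T00:48-00:52Z, STATUS 00:47:50Z, VERDICTS §226/§243; carried g3-g9; entered by g9 per ls-lead g5 WORDS #4 18:50:25Z) — survives: new-mechanism, problem-relative standard. Load-bearing lever = a LIVE past-w (refuter refuter-ls-knife-crit-1-g9-0, 2026-08-27T19:06:57Z; prior: doi:10.2206/kyushujm.72.35 Sono 2018 eq.(2.4), Thm 2.3, Kuehn-Robles-Zeindler Math. Z. 291 (2019), doi:10.4064/aa150-1-3 BCY 2011 [corpus:paper:arxiv-1802.10521 p7 L21-L37], arXiv:2211.02515 s2 (2.16)-(2.33), s8 (8.5), Lemma 8.1, arXiv:2208.01783 Conrey-Rodgers, arXiv:0711.0718 p7 CFZ swap counting, arXiv:1304.3199 FKM d3 4/7, doi:10.4064/aa-47-1-29-56 Heath-Brown d3, arXiv:1811.08672 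Fouvry-Radzi)

History (route lifecycle, newest last):
- 2026-08-27T11:33:52Z · rev 2: informal re-worded for TauTwoSlotExplicit (planner-ls-knife-plan-g0-0)
- 2026-08-27T13:40:33Z · rev 5: informal re-worded for TauTwoSlotExplicit (planner-ls-knife-plan-g1-0)
- 2026-08-27T13:46:18Z · rev 6: informal re-worded for PsiDegOneSlotsExplicit, TauTwoSlotExplicit, GradedClosesExplicit (planner-ls-knife-plan-g1-0)
- 2026-08-27T17:55:32Z · rev 9: dropped InClassSideTables — tenure ls-knife-plan g2 (ls-lead WORDS #14 17:22:49Z (2)): (b) DROP stmt-Parity-20016 InClassSideTables — settled MISSTATED-AS-TYPED (u ≡ 1 admissible ⇒ ⟺ ForAl (planner-ls-knife-plan-g2-0)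
- 2026-08-27T18:04:24Z · rev 11: informal re-worded for InClassSideTables (planner-ls-knife-plan-g2-0)
- 2026-09-03T13:03:46Z · DORMANT — reconciler: no traction for 5 d (last activity statement-checked at 2026-08-29T12:23:10Z); parked, not closed — `ledger route dormant route-Parity-ZDegreeToepli (operator:999:2831999)

sub-problem: GeneralizedHardyLittlewood · status: dormant · opened operator:999:44836 2026-08-27T03:53:55Z · rev 17 · ledger route-Parity-ZDegreeToeplitzBand
GENERATED by the gate from the ledger (D-0016/17). Provers cite these decls: `theorem foo : Summit.Parity.GeneralizedHardyLittlewood.Theses.ZDegreeToeplitzBand.<Decl> := …` in Summits/Parity/GeneralizedHardyLittlewood/Theorems/<Name>.lean.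
-/

namespace Summit.Parity.GeneralizedHardyLittlewood.Theses.ZDegreeToeplitzBand

open scoped BigOperators Topology Manifold Classical MeasureTheory ProbabilityTheory Matrix InnerProductSpace ComplexConjugate ContinuousMap
open Filter Set Function TopologicalSpace MeasureTheory

attribute [summit_statement] _root_.GeneralizedHardyLittlewood
attribute [summit_statement] _root_.Literature.NumberTheory.LFunctions.Zhang2022.Skeleton.Theorem1

/-- item stmt-Parity-20014 · crux · rank 2 · SPLIT (gen 1) into ShortPairsCrossDegOne, ShortPairsDualDegOne, LongPairsGradedTables + glue PsiGradedTablesOfClasses · direct attempts still welcome (low priority) · by operator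
why it might fail: X₂ needs the |d|=2 wrap-around — a bilinear Kl₃ form to prime moduli p∼P with a μ∗χb variable of length up to P⁴ — to cancel or converge; in print only box-wise (KMS 2017 Thms 1.1/1.3, Voronoi, BV); a non-convergent wrap means no X₂ and the slot is false.
sources: Zhang2022LandauSiegel, KowalskiMichelSawin2017, Katz1988, arXiv:1304.3199, arXiv:1211.6043, arXiv:1802.09849
[crux] K1 (EXISTENCE; the card's K1″ lives here). For all large c′ there are pair functionals X₁^ψ,
Y₁^ψ, X₂^ψ such that, under (A) and eventually in D, for in-class profiles: τ₁^ψ(conj Q_g, H_f) =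
X₁(f,g)·𝔞𝔓 + o(𝔞𝔓), τ₁^ψ(conj Q_{g₂}, conj Q_{g₁}) = Y₁(g₁,g₂)·𝔞𝔓 + o(𝔞𝔓), and the NEW table
τ₂^ψ(conj Q_g, H_f) = X₂(f,g)·𝔞𝔓 + o(𝔞𝔓) (τ_d^ψ = `zDegMeanPsi c' χ d`, Zhang lengths ⌊P⌋+1). In
Zhang's bookkeeping (F2 note, graded Lemma 8.1): entry_d = Θ^{(d)} + conj Θ^{(−d)}, the e ≥ 2 half
is o(𝔓) on σ = 3/2, and the |d| = 2 half is a Kl₃-correlation: X₂ = a bilinear form (μ∗χb)_r ⊗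
(d₃)_h coupled by h·n ≡ r (mod p), h ∈ ℤ∖{0} SIGNED (the ψ(−1) of τ(ψ)³τ(ψ̄)³ = ψ(−1)p³ cancels
against the three Poisson/Voronoi signs only with both signs of h; crit-1 02:33:19Z (3)); X₂^{diag}
= the family h·n = r (= the recipe class a·m·n = l₁l₂l₃, live at order 𝔞𝔓 by the R1 census); X₂
exists iff the wrap h·n ≡ r, h·n ≠ r cancels or converges. Census-level evidence, not an item:
`KnifeEdge.TauTwoLivePsiZhang` (τ₂ ≫ 𝔞𝔓 on flat data). DECIDING typed crux (director's K1″); typed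
split in tree: `CrossMeanSplit c' 2 Tdiag Twrap` ∧ `DiagMain Tdiag X₂` (K1″a) ∧ `WrapNegligible
Twrap` (K1″b) ⇒ `TauTwoTablePsi c' X -/
@[route_item "route-Parity-ZDegreeToeplitzBand"]
def PsiGradedTables : Prop :=
  ∃ c₀ : ℝ, ∀ c' : ℝ, c₀ ≤ c' → ∃ X₁ Y₁ X₂ : Literature.NumberTheory.LFunctions.Zhang2022.KnifeEdge.PairFunctional, Literature.NumberTheory.LFunctions.Zhang2022.KnifeEdge.CrossTablePsi c' 1 X₁ ∧ Literature.NumberTheory.LFunctions.Zhang2022.KnifeEdge.DualCrossTablePsi c' 1 Y₁ ∧ Literature.NumberTheory.LFunctions.Zhang2022.KnifeEdge.TauTwoTablePsi c' X₂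

-- parent: PsiGradedTables · child (gen 1)
/--     item stmt-Parity-20446 · crux · rank 203 · open
    parent: PsiGradedTables · by planner
    why it might fail: Wrap-or-dark: below the wrap every long cell is χ-uncompensated (dark); a live functional needs the |d|=2 wrap with both Kl₃ variables below √p (no power saving in print: KMS/FKM, Korolev) or an unmatched (A)-identity Lemma 4.4 lacks; a D-periodic wrap (p ≡ a mod D) leaves no D-free functional.
    sources: Zhang2022LandauSiegel, KowalskiMichelSawin2017, arXiv:1211.6043, arXiv:1911.09981, arXiv:1511.01636, p487998
[crux] 𝒳₂ — THE FULL-CLASS REMAINDER = the K-len OBSTRUCTION ITEM OF RECORD, typed (class call (a+b)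
2026-08-27; director acceptance test 09:29:51Z (a) «declared crux, never an aside» ∧ (b) «typed as
the K-len obstruction item with a falsifier»; HELD — not a prover target): for all large c′ there
are pair functionals X₁, Y₁, X₂ with the degree-1 ψ-graded cross and dual tables on the NON-short
in-class pairs (¬ShortPairs: total log-length ≥ 1, the full-length cells) and the degree-2 table
`TauTwoTablePsi c' X₂` on all in-class pairs — (A)-asymptotics with NAMED functionals for exactly
the cells Zhang's printed engine does not evaluate (M-RULEBOOK (E4.m): every arrangement keeps an
outside leg; 𝕄 returns UNEVALUATED, theory 09:21:50Z). At ρ the irreducible object is 𝒳₂ := Σ_{ψ,ρ}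
𝔠*(ρ,ψ)·Z(ρ,ψ)⁻²·L^{(i)}(ρ+β,χψ)·L^{(j)}(ρ+β′,χψ)·ω(ρ), (β,β′) not two distinct members of
{β₁,β₂,β₃} (K1A-CENSUS v1.2 §6; KNIFE-EDGES §4 [v2.20] (d)(ii)); in Zhang's Kloosterman bookkeeping
it is the |d| = 2 wrap h·n ≡ r (mod p), h·n ≠ r (K1″b `KnifeEdge.WrapNegligible`: a bilinear Kl₃
form to prime moduli p ∼ P with a μ∗χb variable of length up to P⁴, typed split
`tauTwoTablePsi_of_split` p487998). A NEW M -/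
@[route_item "route-Parity-ZDegreeToeplitzBand"]
def LongPairsGradedTables : Prop :=
  ∃ c₀ : ℝ, ∀ c' : ℝ, c₀ ≤ c' → ∃ X₁ Y₁ X₂ : Literature.NumberTheory.LFunctions.Zhang2022.KnifeEdge.PairFunctional, Literature.NumberTheory.LFunctions.Zhang2022.KnifeEdge.CrossTablePsiOn c' (fun f f' g g' => ¬ Literature.NumberTheory.LFunctions.Zhang2022.KnifeEdge.ShortPairs f f' g g') 1 X₁ ∧ Literature.NumberTheory.LFunctions.Zhang2022.KnifeEdge.DualCrossTablePsiOn c' (fun f f' g g' => ¬ Literature.NumberTheory.LFunctions.Zhang2022.KnifeEdge.ShortPairs f f' g g') 1 Y₁ ∧ Literature.NumberTheory.LFunctions.Zhang2022.KnifeEdge.TauTwoTablePsi c' X₂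

-- parent: PsiGradedTables · child (gen 1)
/--     item stmt-Parity-20444 · support · rank 201 · open
    parent: PsiGradedTables · by planner
    why it might fail: A live printed-type leg the count missed (count flipped once, 10:46:54Z→10:59:03Z); and as typed over ALL kinked short pairs it needs K0 (stmt-Parity-20016, open) for the rough pieces.
    sources: Zhang2022LandauSiegel, p516582, p521442
[support] K1 ON THE HALF-CLASS C′ = ShortPairs, degree-1 CROSS table (class call (a+b) 2026-08-27,
HOME/knife/CLASS-CALL.md v1.1): for all large c′ there is a pair functional X₁ with the degree-1
ψ-graded cross table ⟨Z(ρ,ψ)·conj Q_g, H_f⟩ ON short pairs under (A), eventually in D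
(`KnifeEdge.CrossTablePsiOn c' ShortPairs 1 X₁`, p516582; 4 printed-type legs, K1A-CENSUS v1.2 §5).
PREDICTED DARK by the K1″a hand's order count v2 10:59:03Z (K-leaf RIGHT = two-L formula I: relative
L′²α⁴ ≤ 𝓛⁻³²; LEFT diagonal L′⁴α⁴; N-leaf unit-dark) and by theory ERRATUM E-PTD-1 (4) 11:15:05Z
(ψ̄-data χf⋆χg, every l-sum χ-twisted ⇒ (A)-dipoles ⇒ dark below the wrap; live only at load ≥ 1 =
outside ShortPairs; PTD-READING v0.4 a3694b49b07e2557) ⇒ X₁ := 0 is the expected witness (Sketch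
`shortPairsCrossDegOne_of_dark`), CLAIMED until DISPLAY #4's X₁ paragraph is derived (same standard
as DISPLAY #1–#3, modulo K0(pw-C²)) and (q)-read. PRICING (theory (G1) 11:21:56Z): as a standalone
Prop over the bare kinked class it is CLOSABLE ONLY AFTER stmt-Parity-20016 (K0 on kinked profiles)
+ the 𝔅-density of pw-C² short pairs + kernel darkness on the pw-C² sub-class (display-level
content; rung `KnifeEdge.crossTa -/
@[route_item "route-Parity-ZDegreeToeplitzBand"]
def ShortPairsCrossDegOne : Prop :=
  ∃ c₀ : ℝ, ∀ c' : ℝ, c₀ ≤ c' → ∃ X₁ : Literature.NumberTheory.LFunctions.Zhang2022.KnifeEdge.PairFunctional, Literature.NumberTheory.LFunctions.Zhang2022.KnifeEdge.CrossTablePsiOn c' Literature.NumberTheory.LFunctions.Zhang2022.KnifeEdge.ShortPairs 1 X₁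

-- parent: PsiGradedTables · child (gen 1)
/--     item stmt-Parity-20445 · support · rank 202 · open
    parent: PsiGradedTables · by planner
    why it might fail: Count flipped v1→v2 in 13 min (10:46:54Z→10:59:03Z): if DISPLAY #4's Euler table re-books the gcd pair t = t_a·t_b, the cell is one L′(1,χ) short of 𝔞𝔓 and no FIXED Y₁ fits the slot as typed; and as typed it needs K0 (20016) for rough pieces.
    sources: Zhang2022LandauSiegel, p516582, p521442, p484034
[support] K1 ON THE HALF-CLASS C′ = ShortPairs, degree-1 DUAL table — ShortPairsCrossDegOne's TWIN
under count v2 (class call (a+b) 2026-08-27, CLASS-CALL v1.1): for all large c′ there is a FIXED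
pair functional Y₁ with the degree-1 ψ-graded dual table ⟨Z(ρ,ψ)²·conj Q_{g₂}, Z(ρ,ψ)·conj Q_{g₁}⟩
ON short pairs in 𝔞𝔓-currency under (A), eventually in D (`KnifeEdge.DualCrossTablePsiOn c'
ShortPairs 1 Y₁`, p516582) = E₀'s y₁|short. PREDICTED DARK by the K1″a hand's HEADS-UP v2 10:59:03Z,
which SUPERSEDES and withdraws its 10:46:54Z L′¹/«mis-currency» count: the two-L formula I_ψ̄ of
term_K LEFT carries one more χ-twisted factor L(1+s₂+w−β₃,χ) (gcd pair t = t_a·t_b; the t_a-sum is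
an (A)-dipole ≍ L′/log P by Lemma A, not ≈ its t_a = 1 term) ⇒ term_K LEFT ≍ L′²α𝔭 = 𝔞𝔭·O(α):
currency-CONSISTENT and DARK by π𝓛⁻⁹; term_K RIGHT ≍ L′²α𝔭 dark; term_ZN unit-dark ⇒ Y₁ := 0 is the
expected witness (Sketch `shortPairsDualDegOne_of_dark`); theory ERRATUM E-PTD-1 (4): Y₁'s darkness
is the unit-free two-L mechanism (𝔯′_j = O(1), no 1/α). CLAIMED until DISPLAY #4 (the Euler tables
written out) + crit-1 (q)-read + theory verdict. NO rescaled slot D2′, NO `LOnePrimeUpperA` (theory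
desk 11:21:56Z: (T1) NO -/
@[route_item "route-Parity-ZDegreeToeplitzBand"]
def ShortPairsDualDegOne : Prop :=
  ∃ c₀ : ℝ, ∀ c' : ℝ, c₀ ≤ c' → ∃ Y₁ : Literature.NumberTheory.LFunctions.Zhang2022.KnifeEdge.PairFunctional, Literature.NumberTheory.LFunctions.Zhang2022.KnifeEdge.DualCrossTablePsiOn c' Literature.NumberTheory.LFunctions.Zhang2022.KnifeEdge.ShortPairs 1 Y₁

-- parent: PsiGradedTables · glue (gen 1)
/--     item stmt-Parity-20447 · support · rank 204 · closed · proved by Summit.Parity.GeneralizedHardyLittlewood.Theorems.psiGradedTablesOfClasses_proof (prover)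
    parent: PsiGradedTables · GLUE: children ⟹ parent · by planner
K1 from its class children: take c′ ≥ the max of the three thresholds; piecewise functionals X₁ :=
fun f f′ g g′ => if KnifeEdge.ShortPairs f f′ g g′ then X₁ˢ f f′ g g′ else X₁ᴸ f f′ g g′ (classical
if), likewise Y₁, and X₂ from the long child; each table splits pointwise in the pair (by_cases on
ShortPairs + simpa [hs]). PROVED (19 lines, std axioms) as psiGradedTables_of_split in
HOME/knife/len/route-ZDegreeToeplitzBand/classcall/Sketch.lean sha16 796308d61ff6dd96 — a prover
lands it verbatim (imports: this route file +
Literature.NumberTheory.LFunctions.Zhang2022.KnifeEdgeLenZDegreePsiOn). -/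
@[route_item "route-Parity-ZDegreeToeplitzBand"]
def PsiGradedTablesOfClasses : Prop :=
  ShortPairsCrossDegOne → ShortPairsDualDegOne → LongPairsGradedTables → PsiGradedTables

-- `PsiGradedTablesOfClasses` holds: proved by `Summit.Parity.GeneralizedHardyLittlewood.Theorems.psiGradedTablesOfClasses_proof` (its module imports this route file, so no `_holds` link can be stated here).

/-- item stmt-Parity-20032 · crux · rank 2 · open · by planner
why it might fail: On long / x-long pairs the degree-2 cell is WRAP-OR-DARK (X2-HOLD v2.1): a closed form E.X₂psiDiag satisfying the table needs the Kl₃ wrap h·n ≡ r (p), h·n ≠ r to be o(𝔞𝔓) on all boxes up to P⁴ — in print only box-wise (KMS 2017 Thms 1.1/1.3); else no E exists and the slot is false.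
sources: Zhang2022LandauSiegel, KowalskiMichelSawin2017, arXiv:1802.09849, p487998, p516582
[crux α2-deg2 EXPLICIT = K1″, XL, HELD — typed 2026-08-27 by ls-knife-plan g1 (lead WORDS #11
(4)(b); theory / crit-1 no objection)] The CLOSED-FORM-RESTRICTED TWIN of the degree-2 conjunct of
the route's FULL-CLASS REMAINDER 𝒳₂ = `LongPairsGradedTables` (stmt-Parity-20446, the K-len
OBSTRUCTION object of record, CLASS-CALL.md v1.2 §3): for all large c′ there is E :
KnifeEdge.PsiGradedClosedForms with `TauTwoTablePsi c′ E.X₂psiDiag` on ALL in-class pairs.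
EQUIVALENT to the K1″ split form ∃ Tdiag Twrap, `CrossMeanSplit c′ 2 Tdiag Twrap ∧ DiagMain Tdiag
E.X₂psiDiag ∧ WrapNegligible Twrap` (K1″a diagonal family h·n = r carries the closed form, K1″b the
Kl₃ wrap cancels): `tauTwoTablePsi_of_split` (p487998) one way, `crossMeanSplit_trivial` the other
(planner Sketch.lean rc 0: `tauTwoSlotExplicitSig_of_split`, `split_of_tauTwoSlotExplicitSig`);
implies 20446's third conjunct pointwise (`tauTwo_exists_of_explicit`). TYPING NOTES: ∃ E, no
instance named (E₀ does not type on the full class, K1A-CENSUS v1.2 §7 — the long cells contain 𝒳₂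
:= Σ_{ψ,ρ} 𝔠*(ρ,ψ)·Z(ρ,ψ)⁻²·L^{(i)}(ρ+β,χψ)·L^{(j)}(ρ+β′,χψ)·ω(ρ), (β,β′) not two distinct members
of {β₁,β₂,β₃}, a NEW MEAN-VALUE INPUT, M-RULEBOOK (E4.m -/
@[route_item "route-Parity-ZDegreeToeplitzBand"]
def TauTwoSlotExplicit : Prop :=
  ∃ c₀ : ℝ, ∀ c' : ℝ, c₀ ≤ c' → ∃ E : Literature.NumberTheory.LFunctions.Zhang2022.KnifeEdge.PsiGradedClosedForms, Literature.NumberTheory.LFunctions.Zhang2022.KnifeEdge.TauTwoTablePsi c' E.X₂psiDiag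

/-- item stmt-Parity-20015 · crux · rank 3 · SPLIT (gen 1) into ShortPairsTauTwoDark, ShortPairsSchurClose + glue PsiGradedTablesCloseOfShort · direct attempts still welcome (low priority) · by operator
why it might fail: LIKELY PRODUCT is the other horn `GradedPSD` (graded B-AH⁺): X₂^{diag} is model-consistent, the Kl₃ wrap must cancel, no (A)-independent biased source is located (ref-1: ANSWERED-NULL) — then the tables are PSD at main order and nothing closes.
sources: Zhang2022LandauSiegel, KowalskiMichelSawin2017, p485449, p485599, p485893, p489549
[crux] K2 (SIGN). If (A)-characters recur (¬ ForAllLarge ¬(A)), then for all large c′ and ALL pair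
functionals X₁, Y₁, X₂ satisfying the three ψ-graded tables at c′ (degree-1 cross `CrossTablePsi c'
1 X₁`, degree-1 dual `DualCrossTablePsi c' 1 Y₁`, degree-2 `TauTwoTablePsi c' X₂`), the graded 3×3
main-term matrix [[𝔅f, X̄₁, X̄₂],[X₁, 𝔅g₁, Ȳ₁],[X₂, Y₁, 𝔅g₂]] fails PSD on some in-class design
(`GradedCloses X₁ Y₁ X₂`). The tables pin X on in-class pieces (`crossTablePsi_unique`), so this is
the closing condition for THE functionals, not for unnamed ones (critic pin P-X, option β split; not
option γ). Dichotomy of record: exactly one of `GradedCloses`/`GradedPSD`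
(`gradedCloses_or_gradedPSD`, p485449); X₂ = 0 horn = Schur test |X₁|²/𝔅f + |Y₁|²/𝔅g₂ > 𝔅g₁
(`gradedClosesPsi_of_schur_dark`). STATUS (crit-1 kernel finding): GLUE-FACING, not the deciding
crux — given K0 ∧ K1 it is ⟺ ForAllLarge ¬(A) (`gradedClosesPsi_iff_notAEventually_closed`; T1 line
by name `theorem1_or_witnesses_agree`, p489386); its kernel form is α3 `GradedCloses X₁psi Y₁psi
X₂psi` for the explicit defs α1 ((A)-free real analysis, decidable), reached through the birth
skeleton's `stub_candidatesClose` (= α2 ∧ α3 by co -/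
@[route_item "route-Parity-ZDegreeToeplitzBand"]
def PsiGradedTablesClose : Prop :=
  ¬ Literature.NumberTheory.LFunctions.Zhang2022.Skeleton.ForAllLarge (fun D _ χ => ¬ Literature.NumberTheory.LFunctions.Zhang2022.Skeleton.AssumptionA D χ) → ∃ c₀ : ℝ, ∀ c' : ℝ, c₀ ≤ c' → ∀ X₁ Y₁ X₂ : Literature.NumberTheory.LFunctions.Zhang2022.KnifeEdge.PairFunctional, Literature.NumberTheory.LFunctions.Zhang2022.KnifeEdge.CrossTablePsi c' 1 X₁ → Literature.NumberTheory.LFunctions.Zhang2022.KnifeEdge.DualCrossTablePsi c' 1 Y₁ → Literature.NumberTheory.LFunctions.Zhang2022.KnifeEdge.TauTwoTablePsi c' X₂ → Literature.NumberTheory.LFunctions.Zhang2022.KnifeEdge.GradedCloses X₁ Y₁ X₂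

-- parent: PsiGradedTablesClose · child (gen 1)
/--     item stmt-Parity-20430 · crux · rank 302 · open
    parent: PsiGradedTablesClose · by planner
    why it might fail: PrintedTypeDark(short), count v2 10:59:03Z: x₁,y₁,x₂|short all dark ⇒ tables hold with X₁=Y₁=0 ⇒ the horn needs 𝔅g₁<0, impossible ⇒ item ⇔ ForAllLarge ¬(A) (Sketch.shortPairsSchurClose_iff_notAEventually_of_dark): vacuous or summit-strength ⇒ retire.
    sources: Zhang2022LandauSiegel, p521869, p516582, p521442, p485449
[crux] K2 ON THE HALF-CLASS — the C′ SIGN TEST (the thesis with its degree-2 lever amputated, crit-1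
C1 09:29:58Z L2; class call (a+b) 2026-08-27, CLASS-CALL v1.1): if (A)-characters recur (¬
ForAllLarge ¬(A)), then for all large c′ and ALL pair functionals X₁, Y₁ satisfying the degree-1
cross and dual ψ-graded tables ON ShortPairs (pinned there: `KnifeEdge.crossTablePsiOn_unique`),
some in-class triple (f, g₁, g₂) of pairwise short pairs with 𝔅(f), 𝔅(g₂) > 0 violates the
tridiagonal Schur bound: 𝔅(g₁) < |X₁(f,g₁)|²/𝔅(f) + |Y₁(g₁,g₂)|²/𝔅(g₂). With ShortPairsTauTwoDark it
gives the parent K2 (glue: short tables from the full ones by `CrossTablePsi.on`, X₂ = 0 on the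
triple's pair (f,g₂) by `eq_zero_of_tauTwoDarkShort`, amplitudes (−X₁/𝔅f, 1, −conj Y₁/𝔅g₂),
`gradedMainMatrix_congr` + `gradedQuadForm_dark_schur_neg`; no K0), and with K0 +
ShortPairsCrossDegOne + ShortPairsDualDegOne it gives Theorem 1 directly
(`gradedClosesPsiOn_short_of_schur` → `theorem1_of_gradedClosesPsiOn_pack_eventually`, p521869) —
the half-class layer decides the rung WITHOUT LongPairsGradedTables (𝒳₂). EXPECTED FATE UNDER COUNT
v2 (typer-1 HEADS-UP v2 10:59:03Z NET «short class PrintedTypeDark»: x₁, y₁, x₂ A -/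
@[route_item "route-Parity-ZDegreeToeplitzBand"]
def ShortPairsSchurClose : Prop :=
  ¬ Literature.NumberTheory.LFunctions.Zhang2022.Skeleton.ForAllLarge (fun D _ χ => ¬ Literature.NumberTheory.LFunctions.Zhang2022.Skeleton.AssumptionA D χ) → ∃ c₀ : ℝ, ∀ c' : ℝ, c₀ ≤ c' → ∀ X₁ Y₁ : Literature.NumberTheory.LFunctions.Zhang2022.KnifeEdge.PairFunctional, Literature.NumberTheory.LFunctions.Zhang2022.KnifeEdge.CrossTablePsiOn c' Literature.NumberTheory.LFunctions.Zhang2022.KnifeEdge.ShortPairs 1 X₁ → Literature.NumberTheory.LFunctions.Zhang2022.KnifeEdge.DualCrossTablePsiOn c' Literature.NumberTheory.LFunctions.Zhang2022.KnifeEdge.ShortPairs 1 Y₁ → ∃ (f f' g₁ g₁' g₂ g₂' : ℝ → ℂ), Literature.NumberTheory.LFunctions.Zhang2022.KnifeEdge.InClassPiece f f' ∧ Literature.NumberTheory.LFunctions.Zhang2022.KnifeEdge.InClassPiece g₁ g₁' ∧ Literature.NumberTheory.LFunctions.Zhang2022.KnifeEdge.InClassPiece g₂ g₂' ∧ Literature.NumberTheory.LFunctions.Zhang2022.KnifeEdge.ShortPairs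 f f' g₁ g₁' ∧ Literature.NumberTheory.LFunctions.Zhang2022.KnifeEdge.ShortPairs f f' g₂ g₂' ∧ Literature.NumberTheory.LFunctions.Zhang2022.KnifeEdge.ShortPairs g₁ g₁' g₂ g₂' ∧ 0 < Literature.NumberTheory.LFunctions.Zhang2022.mainTermForm f f' ∧ 0 < Literature.NumberTheory.LFunctions.Zhang2022.mainTermForm g₂ g₂' ∧ Literature.NumberTheory.LFunctions.Zhang2022.mainTermForm g₁ g₁' < ‖X₁ f f' g₁ g₁'‖ ^ 2 / Literature.NumberTheory.LFunctions.Zhang2022.mainTermForm f f' + ‖Y₁ g₁ g₁' g₂ g₂'‖ ^ 2 / Literature.NumberTheory.LFunctions.Zhang2022.mainTermForm g₂ g₂'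

-- parent: PsiGradedTablesClose · child (gen 1)
/--     item stmt-Parity-20429 · support · rank 301 · open
    parent: PsiGradedTablesClose · by planner
    sources: Zhang2022LandauSiegel, p516582, p521442, p484034
[support] x₂|short DARK — DERIVED IN 𝕄 for pw-C² pieces, MODULO K0 (class call (a+b) 2026-08-27,
CLASS-CALL v1.1; theory guard-read (G1) 11:21:56Z): for all large c′ the degree-2 ψ-graded cross
table is dark on ALL in-class (kinked) short pairs — for in-class pieces f, g short of log-lengths
θ_f + θ_g < 1 (fixed before D), τ₂^ψ(conj Q_g, H_f) = o(𝔞𝔓) under (A), eventually in D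
(`KnifeEdge.TauTwoDarkShort c'`, p516582). OF RECORD: K1A-DISPLAY-X2short da1580ca30c0ab25 +
K1A-DISPLAY-3-Daudit v1.0a 24fccd0f8afb1eb3 (the D-POWER AUDIT), theory verdict PASS-WITH-NOTES
10:41:08Z (review 478882a294c715bf; M-RULEBOOK v0.12 (D11‴): PROPOSITION OF RECORD x₂|short,
desk-derived in 𝕄, rate 𝓛⁻¹, MODULO K0 for the pieces — printed-type for pw-C², OWED for
rough/H¹-only = InClassSideTables; «LEMMA B, absolute c < 9» WITHDRAWN as a requirement), crit-1
(q)-read PASS-AS-COUNT 10:34:08Z (QREAD-DISPLAY3.md 2c13612316e9e375). Route: (M4) Z(ρ,ψ)⁻² = 𝔲·Z̃⁻¹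
unit-lowering + Lemma 4.8; Lemma 8.1 summand with a₁ = D·(δ_D ⋆ υ ⋆ χg ⋆ χf), a₂ = ν·1_{<D⁴}; main
terms D^{−1/2}-dark (rule (M-dark)), error legs at the printed margins. Kernel reduction available:
`KnifeEdge.tauTwoDarkShort_of_dense_eventually` / `c -/
@[route_item "route-Parity-ZDegreeToeplitzBand"]
def ShortPairsTauTwoDark : Prop :=
  ∃ c₀ : ℝ, ∀ c' : ℝ, c₀ ≤ c' → Literature.NumberTheory.LFunctions.Zhang2022.KnifeEdge.TauTwoDarkShort c'

-- parent: PsiGradedTablesClose · glue (gen 1)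
/--     item stmt-Parity-20431 · support · rank 303 · closed · proved by Summit.Parity.GeneralizedHardyLittlewood.Theorems.psiGradedTablesCloseOfShort_proof (prover)
    parent: PsiGradedTablesClose · GLUE: children ⟹ parent · by planner
K2 from its half-class children: on the (A)-recurrent horn take c′ ≥ max(c₁,c₂); short tables from
the full ones (KnifeEdge.CrossTablePsi.on / DualCrossTablePsi.on); X₂ f f′ g₂ g₂′ = 0 on the
triple's short pair by KnifeEdge.eq_zero_of_tauTwoDarkShort; then KnifeEdge.gradedMainMatrix_congr
rfl rfl hX₂ + KnifeEdge.gradedQuadForm_dark_schur_neg hB0 hB2 hlt give the negative graded form with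
amplitudes (−X₁/𝔅f, 1, −conj Y₁/𝔅g₂). PROVED (11 lines, std axioms, no K0) as
psiGradedTablesClose_of_split in HOME/knife/len/route-ZDegreeToeplitzBand/classcall/Sketch.lean
sha16 796308d61ff6dd96 — a prover lands it verbatim (imports: this route file +
Literature.NumberTheory.LFunctions.Zhang2022.KnifeEdgeLenZDegreePsiOn). -/
@[route_item "route-Parity-ZDegreeToeplitzBand"]
def PsiGradedTablesCloseOfShort : Prop :=
  ShortPairsTauTwoDark → ShortPairsSchurClose → PsiGradedTablesClose

-- `PsiGradedTablesCloseOfShort` holds: proved by `Summit.Parity.GeneralizedHardyLittlewood.Theorems.psiGradedTablesCloseOfShort_proof` (its module imports this route file, so no `_holds` link can be stated here).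

/-- item stmt-Parity-22438 · crux · rank 3 · open · by planner
why it might fail: If the degree-1/2 cells are dark or PSD-completing on LONG sub-unit poly pairs too (X2-HOLD «wrap-or-dark», DISPLAY #6 F1), no poly class closes: under recurrence the item is then FALSE (short poly pairs are already desk-dark ⇒ Schur needs 𝔅<0, impossible: HOLD-20430, p531342).
sources: Zhang2022LandauSiegel, arXiv:2211.02515, KowalskiMichelSawin2017, p521869, p555689, p564811
[crux, rank 3, L — h2′ = K2 OF RECORD after WAKE R2 (tenure ls-knife-plan g3, 2026-08-27); supplier
NAMED = (a): the sign test on POLYNOMIAL designs with every piece of explicit length θ < 1] K2 ON A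
POLYNOMIAL CLASS. If (A)-characters recur (¬ ForAllLarge ¬(A)), there is a class 𝒞 of pairs
(f,f′),(g,g′) of POLYNOMIAL PIECES OF SUB-UNIT LENGTH (class bound PER PIECE, verbatim the `_poly`
glue's h𝒞: (∃ θ < 1, PolyShortPiece θ f f′) ∧ (∃ θ < 1, PolyShortPiece θ g g′) — NOT `𝒞 ⊆
PolyShortPairs`, which admits θ_f = 1 (E-G5-5); LONG pairs θ_f + θ_g ≥ 1 ARE admitted and are the
live case) such that for all large c′ and ALL pair functionals X₁, Y₁, X₂ satisfying the three
ψ-graded tables ON 𝒞 (`CrossTablePsiOn c′ 𝒞 1 X₁`, `DualCrossTablePsiOn c′ 𝒞 1 Y₁`, `CrossTablePsiOn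
c′ 𝒞 2 X₂` — the tables pin X there, `crossTablePsiOn_unique`), the graded 3×3 main-term matrix
fails PSD on an in-class design whose three pairs lie in 𝒞 (`GradedClosesOn 𝒞 X₁ Y₁ X₂`,
KnifeEdgeLenZDegreePsiOn p521869). TYPING CHECKS (tenure Sketch, rc 0): 𝒞 = ∅ is no witness
(`GradedClosesOn ⊥` is false); the statement is monotone in 𝒞 (tables restrict by `.mono`, class
constraints weaken), so `∃ 𝒞` ≡ the maximal sub-uni -/
@[route_item "route-Parity-ZDegreeToeplitzBand"]
def PsiGradedTablesClosePoly : Prop :=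
  ¬ Literature.NumberTheory.LFunctions.Zhang2022.Skeleton.ForAllLarge (fun D _ χ => ¬ Literature.NumberTheory.LFunctions.Zhang2022.Skeleton.AssumptionA D χ) → ∃ 𝒞 : Literature.NumberTheory.LFunctions.Zhang2022.KnifeEdge.PairClass, (∀ (f f' g g' : ℝ → ℂ), 𝒞 f f' g g' → (∃ θ : ℝ, θ < 1 ∧ Literature.NumberTheory.LFunctions.Zhang2022.KnifeEdge.PolyShortPiece θ f f') ∧ (∃ θ : ℝ, θ < 1 ∧ Literature.NumberTheory.LFunctions.Zhang2022.KnifeEdge.PolyShortPiece θ g g')) ∧ ∃ c₀ : ℝ, ∀ c' : ℝ, c₀ ≤ c' → ∀ X₁ Y₁ X₂ : Literature.NumberTheory.LFunctions.Zhang2022.KnifeEdge.PairFunctional, Literature.NumberTheory.LFunctions.Zhang2022.KnifeEdge.CrossTablePsiOn c' 𝒞 1 X₁ → Literature.NumberTheory.LFunctions.Zhang2022.KnifeEdge.DualCrossTablePsiOn c' 𝒞 1 Y₁ → Literature.NumberTheory.LFunctions.Zhang2022.KnifeEdge.CrossTablePsiOn c' 𝒞 2 X₂ → Literature.NumberTheory.LFunctions.Zhang2022.KnifeEdge.GradedClosesOn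 𝒞 X₁ Y₁ X₂

/-- item stmt-Parity-20459 · crux · rank 4 · open · by planner
why it might fail: Zhang's Prop 7.1/§8–9 main-term calculus must run for kinked (H¹, not C¹) in-class pieces through the (7.2) range (PT⁻², P], where formula I is not in the tree; the P-debt pin; a k ≥ 1 atom at the kink could still shift the main term at order 𝔞𝔓.
sources: Zhang2022LandauSiegel, arXiv:2211.02515, p535985, p533892, p575925
[crux, rank 4, M — REPAIRED K0 = the statement of record for the route's side tables, filed
2026-08-27 by the tenure planner ls-knife-plan g1 (REPAIR DUTY, class misstated: new item + re-glued
`closes`; binders h1/h2 unchanged)] For all large c′, Zhang's in-class dictionary (Prop 7.1 /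
(8.23)) for ONE IN-CLASS PIECE: `KnifeEdge.InClassMeanPiece c′` = for every `InClassPiece u u′`
(kinked on [0,1], u = u′ = 0 on [1,∞): NO jump at the wall n = P) and every ε > 0, ForAllLarge
(AssumptionA D χ → |discMean c′ χ (profPoly χ · u (⌊P⌋+1)) − mainTermForm u u′·𝔞(χ)·𝔓(D)| ≤ ε·𝔞𝔓) —
p535985 `Zhang2022/KnifeEdgeLenZDegreeK0Piece.lean` (ls-knife-K0-p1 g0). WHY A NEW ITEM: the
original K0 `InClassSideTables` (stmt-Parity-20016) quantified `KnifeEdge.InClassMean c′` over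
`Repair.KinkedProfile` (ContinuousOn + right derivative + L²; NO wall condition `u 1 = 0`, which
lives in `InClassPiece.vanish`), so the SHARP CUTOFF u ≡ 1, u′ ≡ 0 was admissible
(`kinkedProfile_const`) and the typed K0 asserted Ξ = 40π·𝔞𝔓(1+o(1)) (`mainTermForm_const_one`) for
a sum with an O(1) jump at the wall — a k = 0 atom whose true mean is ≍ 𝓛⁹𝔓 ≫ 𝔞𝔓 (pub-zhang
STRUCTURE §6; M-RULEBOOK (D13′); K0-p1's dyadic S_j count) ⇒ K0 -/
@[route_item "route-Parity-ZDegreeToeplitzBand"]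
def InClassSideTablesPiece : Prop :=
  ∃ c₀ : ℝ, ∀ c' : ℝ, c₀ ≤ c' → Literature.NumberTheory.LFunctions.Zhang2022.KnifeEdge.InClassMeanPiece c'

-- item stmt-Parity-20033 · support · rank 3 · open · by planner — informal only, no Lean statement yet:
--   [support α3, M — DELIBERATELY LEFT WITHOUT SIGNATURE 2026-08-27 by ls-knife-plan g1 (lead WORDS #11
--   (4)(b) «20031/20033 signatures in the same pass» — answered NO for this item, reason recorded)]
--   GradedCloses E.X₁psi E.Y₁psi E.X₂psiDiag — the (A)-free real-analysis closing step for the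
--   closed-form tables of 20031/20032 (barrier twin GradedPSD; Gram test first:
--   KnifeEdge.gradedPSD_of_gram p493849; cheapest certificate gradedCloses_of_minor02 / kernel row
--   gradedCloses_of_gStar_row p494155; cell ALPHA3-CELL v0.3, ls-ref-1, ENGINE v1.0g). WHY NO SIGNATURE:
--   α3 needs a NAMED instance — with `∃ E` (t

/-- item stmt-Parity-22437 · support · rank 4 · closed · proved by Summit.Parity.GeneralizedHardyLittlewood.Theorems.inClassSideTablesPoly_proof (prover) · by planner
why it might fail: none as mathematics — it is the kernel theorem `DipoleRule.inClassMeanPoly_eventually` (p558282); filed as support; the only failure mode is clerical (statement drift from `KnifeEdge.InClassMeanPoly`).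
sources: Zhang2022LandauSiegel, arXiv:2211.02515, p555689, p558282, p557827
[support, rank 4, S — h0′ = K0 OF RECORD after WAKE R2 (tenure ls-knife-plan g3, 2026-08-27; ls-lead
WORDS #2 18:40:38Z, director CONCUR 19:30:35Z; statement guard crit-1 18:21:36Z (C1)–(C4), theory
(G1)–(G6))] THE SIDE TABLES ON POLYNOMIAL SHORT PIECES: for all large c′, `KnifeEdge.InClassMeanPoly
c′` (KnifeEdgeLenZDegreeK0Poly, p555689) = for every θ < 1 and every `PolyShortPiece θ u u′` (u = a
polynomial piece of log-length θ vanishing at its wall, u′ its derivative) and every ε > 0,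
ForAllLarge (AssumptionA D χ → |discMean c′ χ (profPoly χ · u (⌊P⌋+1)) − mainTermForm u
u′·𝔞(χ)·𝔓(D)| ≤ ε·𝔞𝔓) — Zhang's Prop 7.1/(8.23) dictionary for the class the closing designs are
born in. KERNEL ALREADY: `DipoleRule.inClassMeanPoly_eventually` (Section8ProfileSjPoly, p558282,
ls-knife-K0-p1 g2: rows (S) for polynomial pieces by the LEMMA A/A* dipole engines +
`inClassMeanShort_of_sjRows`-type reduction); the closing file is ONE line `theorem … :
InClassSideTablesPoly := DipoleRule.inClassMeanPoly_eventually` (imports this route file +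
Zhang2022.Section8ProfileSjPoly; checked in the tenure Sketch). WHY A NEW ITEM (not a restate of
20459): the registered K0 `InClassSideTablesPiece` (stmt-Parity- -/
@[route_item "route-Parity-ZDegreeToeplitzBand"]
def InClassSideTablesPoly : Prop :=
  ∃ c₀ : ℝ, ∀ c' : ℝ, c₀ ≤ c' → Literature.NumberTheory.LFunctions.Zhang2022.KnifeEdge.InClassMeanPoly c'

-- `InClassSideTablesPoly` holds: proved by `Summit.Parity.GeneralizedHardyLittlewood.Theorems.inClassSideTablesPoly_proof` (its module imports this route file, so no `_holds` link can be stated here).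

/-- item stmt-Parity-20031 · support · rank 5 · open · by planner
[support α2-deg1 EXPLICIT, typed 2026-08-27 by ls-knife-plan g1 (lead WORDS #11 (4)(b); theory
12:41:28Z / crit-1 12:43:38Z no objection)] The CLOSED-FORM-RESTRICTED TWIN of K1's degree-1 slots:
for all large c′ there is a ψ-graded closed-form table E : KnifeEdge.PsiGradedClosedForms (finite
sums of fixed-kernel sesquilinear atoms, p.typer-1 KnifeEdgeLenZDegreeClosedForms) whose projections
satisfy the degree-1 CROSS table `CrossTablePsi c′ 1 E.X₁psi` and the degree-1 DUAL table
`DualCrossTablePsi c′ 1 E.Y₁psi` on ALL in-class pairs. TYPING NOTES: (i) ∃ E, NO INSTANCE NAMED —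
the instance E₀ does not type on the full class (K1A-CENSUS v1.2 §7: the long cells contain the
unevaluated outside object 𝒳₂), so the director's «no signature over E₀'s projections before E₀
lands» (09:29:51Z) is respected: nothing dangles; an instance closes the item by ⟨E₀, tables⟩. (ii)
Guards automatic (crit-1 12:43:38Z): `CrossTablePsi`/`DualCrossTablePsi` carry the `InClassPiece`
binders, `∀ ε > 0`, `ForAllLarge … AssumptionA D χ →`. (iii) E₀|C′ = NULL DESIGN (DISPLAY #4
d9c044f56c100226, theory PASS-WITH-NOTES 11:37:13Z, crit-1 (q)-read PASS; (q0′)): on ShortPairs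
E.X₁psi = E.Y₁psi = 0 is what the desk -/
@[route_item "route-Parity-ZDegreeToeplitzBand"]
def PsiDegOneSlotsExplicit : Prop :=
  ∃ c₀ : ℝ, ∀ c' : ℝ, c₀ ≤ c' → ∃ E : Literature.NumberTheory.LFunctions.Zhang2022.KnifeEdge.PsiGradedClosedForms, Literature.NumberTheory.LFunctions.Zhang2022.KnifeEdge.CrossTablePsi c' 1 E.X₁psi ∧ Literature.NumberTheory.LFunctions.Zhang2022.KnifeEdge.DualCrossTablePsi c' 1 E.Y₁psi

/-- item stmt-Parity-21346 · aside · rank 9 · open · by planner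
[aside] RETIRED K0 AS ORIGINALLY TYPED — the statement of the dropped item stmt-Parity-20016
(MISSTATED-AS-TYPED: `KnifeEdge.InClassMean` binds `Repair.KinkedProfile`, which has no wall
condition, so u ≡ 1 is admissible and the statement is ⟺ ForAllLarge ¬(A) — K0-MISSTATED.md
9d6c912d0fab6a8c; kernels `kinkedProfile_const` / `mainTermForm_const_one` /
`not_inClassPiece_const_one`, p535985; superseded by stmt-Parity-20459 `InClassSideTablesPiece`,
binder h0 of `closes` since rev 7; dropped rev 9). RE-DECLARED (tenure planner ls-knife-plan g2, rev
10, item stmt-Parity-21346) as an ASIDE — never staffed, never counted, NOT in the cone of `closes`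
— for BUILD SAFETY ONLY: three LANDED Theorems files name this decl and must keep elaborating —
`Theorems/ZDegreeToeplitzBandClassSupport.lean` :63 `theorem1_of_shortPairs (h0 :
InClassSideTables)` (imported by `Theorems/ZDegreeToeplitzBandDarkSchur.lean` and by the registered
20430 skeleton `Cruxes/ShortPairsSchurClose/Lines/dark_schur.lean`),
`Theorems/ZDegreeToeplitzBand/Negative/TypedLayerIffNotAEventually.lean` (ll. 50/70/88/100), and
`Theorems/ZDegreeToeplitzBandAssembly.lean` (the closed assembly item stmt-Parity-20017, `Assembly
:= I -/
@[route_item "route-Parity-ZDegreeToeplitzBand"]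
def InClassSideTables : Prop :=
  ∃ c₀ : ℝ, ∀ c' : ℝ, c₀ ≤ c' → Literature.NumberTheory.LFunctions.Zhang2022.KnifeEdge.InClassMean c'

/-- item stmt-Parity-20017 · assembly · rank 1 · closed · proved by Summit.Parity.GeneralizedHardyLittlewood.Theorems.zDegreeToeplitzBandAssembly_proof (prover) · by operator
sources: Zhang2022LandauSiegel, p485893
[assembly] InClassSideTables → PsiGradedTables → PsiGradedTablesClose → Zhang2022.Skeleton.Theorem1. -/
@[route_item "route-Parity-ZDegreeToeplitzBand"]
def Assembly : Prop :=
  InClassSideTables → PsiGradedTables → PsiGradedTablesClose → Literature.NumberTheory.LFunctions.Zhang2022.Skeleton.Theorem1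

-- `Assembly` holds: proved by `Summit.Parity.GeneralizedHardyLittlewood.Theorems.zDegreeToeplitzBandAssembly_proof` (its module imports this route file, so no `_holds` link can be stated here).

/-! D-0027 §2.1 — DECIDING THEOREM (planner-authored via `route open/edit --closes-file`; by planner-ls-knife-plan-g3-0 2026-08-27T22:03:24Z):
its hypotheses are this route's items and its conclusion the registered leaf `Literature.NumberTheory.LFunctions.Zhang2022.Skeleton.Theorem1` (rung F-S3, D-0061) (glue_lint), and it elaborates with this file. -/

/-- D-0027 §2.1 deciding theorem of route `ZDegreeToeplitzBand` (Parity / GeneralizedHardyLittlewood; rung leaf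
`Zhang2022.Skeleton.Theorem1`), RE-KEYED at WAKE R2 (tenure ls-knife-plan g3, 2026-08-27) on the K0 POLY RE-POSE PAIR:
h0′ `InClassSideTablesPoly` (side tables on polynomial short pieces of sub-unit length — KERNEL, `DipoleRule.inClassMeanPoly_eventually`,
p558282) and h2′ `PsiGradedTablesClosePoly` (K2 on a class 𝒞 of pairs of polynomial pieces of explicit lengths θ < 1: the true
functionals of the three ψ-graded tables ON 𝒞 close on an in-class design inside 𝒞); h1 `PsiGradedTables` (K1, the tables on all
in-class pairs) is unchanged and is restricted to 𝒞 by `CrossTablePsi.on` / `DualCrossTablePsi.on`. Chain: either (A) fails for all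
large `D` — then Theorem 1 is `Skeleton.theorem1_of_eventually_not_assumptionA` — or (A)-characters recur, and then h2′ names the class 𝒞,
h1 restricted to 𝒞 plus h2′ give `KnifeEdge.GradedClosesPsiOn c′ 𝒞` for all large `c′`, and the glue twin
`KnifeEdge.theorem1_of_gradedClosesPsiOn_pack_eventually_poly` (p555689; side tables consumed on the three design pieces only, each a
`PolyShortPiece θ` with θ < 1 by h2′'s class bound) gives Theorem 1. Std axioms; no printed fact is a binder. -/
@[closes "route-Parity-ZDegreeToeplitzBand"] theorem closes (h0 : InClassSideTablesPoly) (h1 : PsiGradedTables) (h2 : PsiGradedTablesClosePoly) :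
    Literature.NumberTheory.LFunctions.Zhang2022.Skeleton.Theorem1 := by
  by_cases hA : Literature.NumberTheory.LFunctions.Zhang2022.Skeleton.ForAllLarge
      (fun D _ χ => ¬ Literature.NumberTheory.LFunctions.Zhang2022.Skeleton.AssumptionA D χ)
  · exact Literature.NumberTheory.LFunctions.Zhang2022.Skeleton.theorem1_of_eventually_not_assumptionA hA
  · obtain ⟨c₁, hK1⟩ := h1
    obtain ⟨𝒞, h𝒞, c₂, hK2⟩ := h2 hA
    refine Literature.NumberTheory.LFunctions.Zhang2022.KnifeEdge.theorem1_of_gradedClosesPsiOn_pack_eventually_poly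
      (𝒞 := 𝒞) h0 ⟨max c₁ c₂, fun c' hc' => ?_⟩ h𝒞
    obtain ⟨X₁, Y₁, X₂, t1, t21, t2⟩ := hK1 c' (le_trans (le_max_left _ _) hc')
    exact ⟨X₁, Y₁, X₂, t1.on 𝒞, t21.on 𝒞, t2.on 𝒞,
      hK2 c' (le_trans (le_max_right _ _) hc') X₁ Y₁ X₂ (t1.on 𝒞) (t21.on 𝒞) (t2.on 𝒞)⟩

end Summit.Parity.GeneralizedHardyLittlewood.Theses.ZDegreeToeplitzBand
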